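import Mathlib.RingTheory.MvPolynomial.Homogeneous
import Mathlib.RingTheory.MvPolynomial.WeightedHomogeneous
import Mathlib.Algebra.Polynomial.BigOperators
import Mathlib.Algebra.Polynomial.Roots
import Mathlib.RingTheory.Ideal.Quotient.Operations
import Literature.Computability.AlgebraicComplexity.DeterminantalComplexity
import Literature.Computability.AlgebraicComplexity.DeterminantalComplexityProofs
import Literature.Computability.AlgebraicComplexity.VPDeterminantalQPProofs
import Summits.ValiantsHypothesis.ValiantsHypothesis.Theorems.BorderApolarityFixedWitnessObstructionQPInterp
import Summits.ValiantsHypothesis.ValiantsHypothesis.Theorems.BorderApolarityFixedWitnessObstructionQPInvReprOfDetRepr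
import Summits.ValiantsHypothesis.ValiantsHypothesis.Theorems.BorderApolarityFixedWitnessObstructionQPDeborder

/-!
# Border apolarity, crux `FixedWitnessObstructionQP` — de-bordering by ORDER

Route `ValiantsHypothesis/BorderApolarity`, crux item `stmt-ValiantsHypothesis-5778`, line
`toric-face-debordering`, reshape 4 (lead seat -2): the cost of de-bordering a one-parameter family of
affine determinants is governed by the ORDER of the family — the index of the first `ε`-coefficient one
wants — and not by the height of the torus weights.

* `hasDetRepr_coeff_det_layers` (**de-bordering by order**): for layers `B₀, …, B_k` of `m × m` matrices
  of LINEAR forms, the coefficient `[ε^k] det (B₀ + ε B₁ + ⋯ + ε^k B_k)` has an affine determinantal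
  expression of size `3 ((m+1)(k+1))^10` — Lagrange/Vandermonde interpolation at the `(m+1)k + 1` nodes
  `ε = 1, 2, …` (each node an honest `m × m` determinant of linear forms, `exists_coeff_eq_sum_eval`,
  `natDegree_det_le_of_forall`) and the landed polynomial sub-additivity of `dc` on forms
  (`stub_invReprOfDetRepr`, `HasInvRepr.finset_sum`, `HasInvRepr.hasDetRepr`).
* `coeff_det_layers_of_le`: layers above `k` do not touch `[ε^k]` (work modulo `ε^{k+1}`), so a longer
  family may be truncated before paying.

This is the `deborder_of_order` lemma asked for by crux 4's card `mvmp-order-debordering`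
(Cruxes/ToricWitnessObstructionQP/Ideas/, stmt-14753) and it REPLACES the height currency of the landed
`stub_deborder` (`…QPDeborder.lean`: weights `≤ B` ⇒ size `3((s+1)(B+1))^10`): after an Egerváry-type
rescaling `diag(ε^p) · A(ε^{-w} x) · diag(ε^q)` of a toric family, the extremal component is the LOWEST
`ε`-coefficient of a holomorphic family and one pays `poly(m) · (order + 1)`; the order is at most
`m · max w` and can be `O(1)` where every exposing weight is huge.  Printed ancestors: Bini 1980 /
Bürgisser 2004 (arXiv:cs/0212057) Lemma 5.5(3), Prop. 5.4 (interpolation de-bordering); Murota 1995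
(combinatorial relaxation: degree of a determinant via potentials).
-/

open MvPolynomial
open scoped BigOperators Matrix Polynomial
open Literature.Computability.AlgebraicComplexity

namespace Summit.ValiantsHypothesis.ValiantsHypothesis.Theorems.BorderApolarityFixedWitnessObstructionQP

set_option linter.dupNamespace false

/-- The determinant of a matrix of linear forms is a form of degree `card n`. [folklore] -/
theorem isHomogeneous_det_of_isHomogeneous_one {n : Type*} [Fintype n] [DecidableEq n]
    {R σ : Type*} [CommRing R] (A : Matrix n n (MvPolynomial σ R))
    (hA : ∀ i j, (A i j).IsHomogeneous 1) : A.det.IsHomogeneous (Fintype.card n) := by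
  rw [Matrix.det_apply]
  refine IsHomogeneous.sum _ _ _ fun π _ => ?_
  have h := IsHomogeneous.prod (φ := fun i : n => A (π i) i) Finset.univ (fun _ => 1)
    fun i _ => hA (π i) i
  simp only [Finset.sum_const, smul_eq_mul, mul_one, Finset.card_univ] at h
  rw [Units.smul_def, zsmul_eq_mul, ← map_intCast (C : R →+* MvPolynomial σ R)]
  simpa only [zero_add] using (isHomogeneous_C _ _).mul h

/-- If every entry of a polynomial matrix has degree `≤ k` then its determinant has degree
`≤ card n · k`. [folklore] -/
theorem natDegree_det_le_of_forall {n : Type*} [Fintype n] [DecidableEq n] {R : Type*} [CommRing R]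
    (M : Matrix n n R[X]) (k : ℕ) (hM : ∀ i j, (M i j).natDegree ≤ k) :
    M.det.natDegree ≤ Fintype.card n * k := by
  rw [Matrix.det_apply]
  refine Polynomial.natDegree_sum_le_of_forall_le _ _ fun g _ => ?_
  calc (Equiv.Perm.sign g • ∏ i, M (g i) i).natDegree ≤ (∏ i, M (g i) i).natDegree := by
        rcases Int.units_eq_one_or (Equiv.Perm.sign g) with sg | sg
        · rw [sg, one_smul]
        · rw [sg, Units.neg_smul, one_smul, Polynomial.natDegree_neg]
    _ ≤ ∑ i, (M (g i) i).natDegree := Polynomial.natDegree_prod_le _ _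
    _ ≤ ∑ _i : n, k := Finset.sum_le_sum fun i _ => hM (g i) i
    _ = Fintype.card n * k := by simp [Finset.sum_const, Finset.card_univ]

/-- **Coefficient extraction by interpolation.** For every `N` and `e ≤ N` there are universal complex
weights `c₀, …, c_N` (a row of the inverse Vandermonde matrix at the nodes `1, …, N+1`,
`exists_vandermonde_dual`) such that `[ε^e] P = Σ_j c_j · P(j+1)` for every polynomial `P` of degree
`≤ N` with coefficients in `ℂ[x]`. [folklore] -/
theorem exists_coeff_eq_sum_eval {σ : Type*} (N : ℕ) (e : Fin (N + 1)) :
    ∃ c : Fin (N + 1) → ℂ, ∀ P : Polynomial (MvPolynomial σ ℂ), P.natDegree ≤ N →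
      P.coeff e = ∑ j : Fin (N + 1), C (c j) * P.eval (C ((((j : ℕ) : ℂ)) + 1)) := by
  obtain ⟨c, hc⟩ := exists_vandermonde_dual N e
  refine ⟨c, fun P hP => ?_⟩
  have hev : ∀ x : MvPolynomial σ ℂ, P.eval x = ∑ i : Fin (N + 1), P.coeff i * x ^ (i : ℕ) :=
    fun x => by
      rw [Polynomial.eval_eq_sum_range' (Nat.lt_succ_of_le hP) x,
        ← Fin.sum_univ_eq_sum_range (fun i => P.coeff i * x ^ i) (N + 1)]
  symm
  calc ∑ j : Fin (N + 1), C (c j) * P.eval (C ((((j : ℕ) : ℂ)) + 1))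
      = ∑ j : Fin (N + 1), ∑ i : Fin (N + 1),
          P.coeff i * C (c j * ((((j : ℕ) : ℂ) + 1) ^ (i : ℕ))) := by
        refine Finset.sum_congr rfl fun j _ => ?_
        rw [hev, Finset.mul_sum]
        refine Finset.sum_congr rfl fun i _ => ?_
        rw [map_mul, map_pow]
        ring
    _ = ∑ i : Fin (N + 1), P.coeff i *
          C (∑ j : Fin (N + 1), c j * ((((j : ℕ) : ℂ) + 1) ^ (i : ℕ))) := by
        rw [Finset.sum_comm]
        refine Finset.sum_congr rfl fun i _ => ?_
        rw [map_sum, Finset.mul_sum]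
    _ = ∑ i : Fin (N + 1), P.coeff i * C (if i = e then 1 else 0) := by
        refine Finset.sum_congr rfl fun i _ => ?_
        rw [hc i]
    _ = P.coeff e := by
        simp only [apply_ite C, map_one, map_zero, mul_ite, mul_one, mul_zero, Finset.sum_ite_eq',
          Finset.mem_univ, if_true]

/-- **De-bordering by ORDER** (the `deborder_of_order` lemma of crux 4's card `mvmp-order-debordering`,
explicit constants `C = 3`, `e₀ = 10`).  Let `B₀, …, B_k` be `m × m` matrices of linear forms and
`Λ = B₀ + ε B₁ + ⋯ + ε^k B_k`.  Then the coefficient `[ε^k] det Λ` — the order-`k` term of the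
holomorphic family `det Λ(ε)` — has an affine determinantal expression of size `3 ((m+1)(k+1))^10`:
`det Λ` has `ε`-degree `≤ m k`, so `[ε^k] det Λ = Σ_{j ≤ (m+1)k} c_j det Λ(j+1)` by interpolation
(`exists_coeff_eq_sum_eval`); each node `det Λ(j+1)` is an honest `m × m` determinant of linear forms,
hence an inverse read-out of size `2 (m+1)^9` (`stub_invReprOfDetRepr`), read-outs add
(`HasInvRepr.finset_sum`) and are bordered into one determinant (`HasInvRepr.hasDetRepr`). [folklore] -/
theorem hasDetRepr_coeff_det_layers {σ : Type} [Fintype σ] [DecidableEq σ] (m k : ℕ)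
    (B : ℕ → Matrix (Fin m) (Fin m) (MvPolynomial σ ℂ)) (hB : ∀ j a b, (B j a b).IsHomogeneous 1) :
    HasDetRepr ((Matrix.det (Matrix.of fun a b =>
        ∑ j ∈ Finset.range (k + 1), Polynomial.monomial j (B j a b))).coeff k)
      (3 * ((m + 1) * (k + 1)) ^ 10) := by
  set M : Matrix (Fin m) (Fin m) (Polynomial (MvPolynomial σ ℂ)) :=
    Matrix.of fun a b => ∑ j ∈ Finset.range (k + 1), Polynomial.monomial j (B j a b) with hM
  -- degree bound `deg_ε det M ≤ m k ≤ (m+1) k`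
  have hdeg : M.det.natDegree ≤ (m + 1) * k := by
    have h1 : M.det.natDegree ≤ Fintype.card (Fin m) * k :=
      natDegree_det_le_of_forall M k fun a b => by
        rw [hM, Matrix.of_apply]
        exact Polynomial.natDegree_sum_le_of_forall_le _ _ fun j hj =>
          (Polynomial.natDegree_monomial_le _).trans (Nat.lt_succ_iff.mp (Finset.mem_range.mp hj))
    rw [Fintype.card_fin] at h1
    exact h1.trans (Nat.mul_le_mul_right k (Nat.le_succ m))
  have hk : k < (m + 1) * k + 1 := by nlinarith
  obtain ⟨c, hc⟩ := exists_coeff_eq_sum_eval (σ := σ) ((m + 1) * k) ⟨k, hk⟩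
  have hcoeff : M.det.coeff k = _ := hc M.det hdeg
  -- each node is an honest determinant of linear forms, hence an inverse read-out
  have hnode : ∀ j : Fin ((m + 1) * k + 1),
      HasInvRepr (C (c j) * M.det.eval (C ((((j : ℕ) : ℂ)) + 1))) (2 * (m + 1) ^ 9) := by
    intro j
    set x : MvPolynomial σ ℂ := C ((((j : ℕ) : ℂ)) + 1) with hx
    have hev : M.det.eval x = ((Polynomial.evalRingHom x).mapMatrix M).det := by
      rw [← Polynomial.coe_evalRingHom, RingHom.map_det]
    have hlin : ∀ a b, ((Polynomial.evalRingHom x).mapMatrix M a b).IsHomogeneous 1 := by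
      intro a b
      rw [RingHom.mapMatrix_apply, Matrix.map_apply, hM, Matrix.of_apply, Polynomial.coe_evalRingHom,
        Polynomial.eval_finsetSum]
      refine IsHomogeneous.sum _ _ _ fun i _ => ?_
      rw [Polynomial.eval_monomial, hx, ← map_pow]
      simpa using (hB i a b).mul (isHomogeneous_C σ (((((j : ℕ) : ℂ)) + 1) ^ i))
    have hhom : (((Polynomial.evalRingHom x).mapMatrix M).det).IsHomogeneous m := by
      simpa using isHomogeneous_det_of_isHomogeneous_one _ hlin
    have hdet : HasDetRepr (((Polynomial.evalRingHom x).mapMatrix M).det) m :=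
      ⟨(Polynomial.evalRingHom x).mapMatrix M, fun a b => (hlin a b).totalDegree_le, rfl⟩
    rw [hev, ← smul_eq_C_mul]
    exact hasInvRepr_smul (c j) (stub_invReprOfDetRepr σ _ m m hhom hdet)
  have hsum := HasInvRepr.finset_sum (Finset.univ : Finset (Fin ((m + 1) * k + 1)))
    (fun j _ => hnode j)
  rw [← hcoeff, Finset.card_univ, Fintype.card_fin] at hsum
  refine HasDetRepr.mono_holds hsum.hasDetRepr ?_
  -- `((m+1)k+1) · 2(m+1)^9 + 1 ≤ 3 ((m+1)(k+1))^10`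
  have hP : 1 ≤ (m + 1) * (k + 1) := Nat.one_le_iff_ne_zero.mpr (by positivity)
  have h1 : (m + 1) * k + 1 ≤ (m + 1) * (k + 1) := by nlinarith
  have h2 : (m + 1) ^ 9 ≤ ((m + 1) * (k + 1)) ^ 9 :=
    Nat.pow_le_pow_left (Nat.le_mul_of_pos_right _ (by omega)) 9
  have h3 : 1 ≤ ((m + 1) * (k + 1)) ^ 10 := Nat.one_le_pow _ _ hP
  calc ((m + 1) * k + 1) * (2 * (m + 1) ^ 9) + 1
      ≤ (m + 1) * (k + 1) * (2 * ((m + 1) * (k + 1)) ^ 9) + 1 :=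
        Nat.add_le_add_right (Nat.mul_le_mul h1 (Nat.mul_le_mul_left 2 h2)) 1
    _ = 2 * ((m + 1) * (k + 1)) ^ 10 + 1 := by ring
    _ ≤ 3 * ((m + 1) * (k + 1)) ^ 10 := by omega

/-- **Truncation**: layers above `k` do not touch the order-`k` coefficient —
`[ε^k] det (Σ_{j ≤ K} ε^j B_j) = [ε^k] det (Σ_{j ≤ k} ε^j B_j)` for `k ≤ K` (the two matrices agree
modulo `ε^{k+1}`, and `det` is a polynomial in the entries). [folklore] -/
theorem coeff_det_layers_of_le {n : Type*} [Fintype n] [DecidableEq n] {R : Type*} [CommRing R]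
    (B : ℕ → Matrix n n R) {k K : ℕ} (hkK : k ≤ K) :
    (Matrix.det (Matrix.of fun a b => ∑ j ∈ Finset.range (K + 1), Polynomial.monomial j (B j a b))).coeff k
      = (Matrix.det (Matrix.of fun a b =>
          ∑ j ∈ Finset.range (k + 1), Polynomial.monomial j (B j a b))).coeff k := by
  set I : Ideal R[X] := Ideal.span {(Polynomial.X : R[X]) ^ (k + 1)} with hI
  set π : R[X] →+* R[X] ⧸ I := Ideal.Quotient.mk I with hπ
  -- the two matrices agree modulo `ε^{k+1}`
  have hent : ∀ a b, π (∑ j ∈ Finset.range (K + 1), Polynomial.monomial j (B j a b)) =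
      π (∑ j ∈ Finset.range (k + 1), Polynomial.monomial j (B j a b)) := by
    intro a b
    rw [hπ, Ideal.Quotient.eq, hI, Ideal.mem_span_singleton]
    rw [← Finset.sum_range_add_sum_Ico _ (Nat.succ_le_succ hkK), add_sub_cancel_left]
    refine Finset.dvd_sum fun j hj => ?_
    have hj' : k + 1 ≤ j := (Finset.mem_Ico.mp hj).1
    refine ⟨Polynomial.monomial (j - (k + 1)) (B j a b), ?_⟩
    rw [Polynomial.X_pow_mul, Polynomial.monomial_mul_X_pow, Nat.sub_add_cancel hj']
  have hdet : π (Matrix.det (Matrix.of fun a b =>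
        ∑ j ∈ Finset.range (K + 1), Polynomial.monomial j (B j a b))) =
      π (Matrix.det (Matrix.of fun a b =>
        ∑ j ∈ Finset.range (k + 1), Polynomial.monomial j (B j a b))) := by
    rw [RingHom.map_det, RingHom.map_det]
    congr 1
    ext a b
    simp only [RingHom.mapMatrix_apply, Matrix.map_apply, Matrix.of_apply]
    exact hent a b
  rw [hπ, Ideal.Quotient.eq, hI, Ideal.mem_span_singleton] at hdet
  obtain ⟨q, hq⟩ := hdet
  have := congrArg (fun p : R[X] => p.coeff k) hq
  simp only [Polynomial.coeff_sub, Polynomial.coeff_X_pow_mul'] at this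
  -- `coeff (X^(k+1) * q) k = 0`
  rw [if_neg (by omega)] at this
  exact sub_eq_zero.mp this

/-- Weighted-homogeneous components of a form are forms of the same degree. [folklore] -/
theorem isHomogeneous_weightedHomogeneousComponent {σ R : Type*} [CommSemiring R]
    {φ : MvPolynomial σ R} {n : ℕ} (hφ : φ.IsHomogeneous n) (w : σ → ℕ) (j : ℕ) :
    (weightedHomogeneousComponent w j φ).IsHomogeneous n := by
  intro d hd
  rw [coeff_weightedHomogeneousComponent] at hd
  split_ifs at hd with h
  · exact hφ hd
  · exact absurd rfl hd

/-- The weight of an exponent is at most (a pointwise bound on the weights) × (its degree). [folklore] -/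
theorem weight_le_mul_weight_one {σ : Type*} (w : σ → ℕ) (W : ℕ) (hw : ∀ i, w i ≤ W) (d : σ →₀ ℕ) :
    Finsupp.weight w d ≤ W * Finsupp.weight (1 : σ → ℕ) d := by
  simp only [Finsupp.weight_apply, Finsupp.sum, Pi.one_apply, smul_eq_mul, mul_one, Finset.mul_sum]
  exact Finset.sum_le_sum fun i _ => by rw [mul_comm]; exact Nat.mul_le_mul_right _ (hw i)

/-- **Torus expansion.** If every monomial of `f` has `w`-weight `≤ N` then
`f(…, s^{w_i} x_i, …) = Σ_{v ≤ N} s^v · wHC_w^v f`. [folklore] -/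
theorem linSubst_diagonal_pow_eq_sum {σ : Type*} [Fintype σ] [DecidableEq σ] (w : σ → ℕ) (s : ℂ)
    (N : ℕ) (f : MvPolynomial σ ℂ) (hN : ∀ d ∈ f.support, Finsupp.weight w d ≤ N) :
    linSubst σ ℂ (Matrix.diagonal fun i => s ^ (w i)) f =
      ∑ v ∈ Finset.range (N + 1), C (s ^ v) * weightedHomogeneousComponent w v f := by
  ext d
  rw [coeff_linSubst_diagonal_pow, coeff_sum]
  simp only [coeff_C_mul, coeff_weightedHomogeneousComponent, mul_ite, mul_zero]
  by_cases hd : d ∈ f.support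
  · rw [Finset.sum_ite_eq (Finset.range (N + 1)) (Finsupp.weight w d) fun v => s ^ v * coeff d f,
      if_pos (Finset.mem_range.mpr (Nat.lt_succ_of_le (hN d hd)))]
  · rw [notMem_support_iff.mp hd]
    simp

/-- **Weighted components of a determinant of linear forms are `ε`-coefficients of the layered
determinant.**  Let `L` be a square matrix of linear forms and `w` a weight; put
`B_j := wHC_w^j ∘ L` (entrywise weight-`j` layer, again linear forms).  Then for every `e`,
`wHC_w^e (det L) = [ε^e] det (B₀ + ε B₁ + ⋯ + ε^e B_e)`: substituting `x_i ↦ s^{w_i} x_i` in `det L`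
is `det` of the substituted matrix, whose entries are `Σ_j s^j B_j` (torus expansion entrywise), so the
polynomial identity `det (Σ_j ε^j B_j) = Σ_v ε^v wHC_w^v (det L)` holds at every `ε = s ∈ ℂ`, hence in
`ℂ[x][ε]` (a nonzero polynomial over a domain has finitely many roots); compare coefficients and truncate
the layers above `e` (`coeff_det_layers_of_le`).  This is the formal-power identity behind Murota's
"degree of a determinant" calculus, in the form the de-bordering lemma consumes. [folklore] -/
theorem weightedHomogeneousComponent_det_eq_coeff {σ : Type*} [Fintype σ] [DecidableEq σ] {ι : Type*}
    [Fintype ι] [DecidableEq ι] (L : Matrix ι ι (MvPolynomial σ ℂ)) (hL : ∀ a b, (L a b).IsHomogeneous 1)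
    (w : σ → ℕ) (e : ℕ) :
    weightedHomogeneousComponent w e L.det =
      (Matrix.det (Matrix.of fun a b => ∑ j ∈ Finset.range (e + 1),
        Polynomial.monomial j (weightedHomogeneousComponent w j (L a b)))).coeff e := by
  -- a pointwise bound on the weights
  set W : ℕ := Finset.univ.sup w with hW
  have hw : ∀ i, w i ≤ W := fun i => Finset.le_sup (f := w) (Finset.mem_univ i)
  -- layers and the layered matrix with `K + 1` layers
  set B : ℕ → Matrix ι ι (MvPolynomial σ ℂ) := fun j => Matrix.of fun a b =>
    weightedHomogeneousComponent w j (L a b) with hB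
  have hΛ : ∀ K : ℕ, (Matrix.of fun a b => ∑ j ∈ Finset.range (K + 1),
      Polynomial.monomial j (weightedHomogeneousComponent w j (L a b))) =
      Matrix.of fun a b => ∑ j ∈ Finset.range (K + 1), Polynomial.monomial j (B j a b) := by
    intro K; rfl
  rw [hΛ e, ← coeff_det_layers_of_le B (Nat.le_add_left e W)]
  -- weights: entries `≤ W`, determinant `≤ N := W · card ι + e` (any bound `≥` both will do)
  set N : ℕ := W * Fintype.card ι + (W + e) with hN
  have hwL : ∀ a b, ∀ d ∈ (L a b).support, Finsupp.weight w d ≤ W + e := by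
    intro a b d hd
    have hdeg : Finsupp.weight (1 : σ → ℕ) d = 1 := hL a b (mem_support_iff.mp hd)
    have := weight_le_mul_weight_one w W hw d
    rw [hdeg, mul_one] at this
    omega
  have hdetHom : L.det.IsHomogeneous (Fintype.card ι) := isHomogeneous_det_of_isHomogeneous_one L hL
  have hwDet : ∀ d ∈ L.det.support, Finsupp.weight w d ≤ N := by
    intro d hd
    have hdeg : Finsupp.weight (1 : σ → ℕ) d = Fintype.card ι := hdetHom (mem_support_iff.mp hd)
    have := weight_le_mul_weight_one w W hw d
    rw [hdeg] at this
    omega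
  -- the polynomial identity, evaluated at every complex scalar `s`
  set Λ : Matrix ι ι (Polynomial (MvPolynomial σ ℂ)) :=
    Matrix.of fun a b => ∑ j ∈ Finset.range (W + e + 1), Polynomial.monomial j (B j a b) with hΛdef
  set Q : Polynomial (MvPolynomial σ ℂ) :=
    Λ.det - ∑ v ∈ Finset.range (N + 1), Polynomial.monomial v (weightedHomogeneousComponent w v L.det)
    with hQ
  have heval : ∀ s : ℂ, Q.eval (C s) = 0 := by
    intro s
    have hentry : ∀ a b, (Polynomial.evalRingHom (C s)) (Λ a b) =
        linSubst σ ℂ (Matrix.diagonal fun i => s ^ (w i)) (L a b) := by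
      intro a b
      rw [hΛdef, Matrix.of_apply, Polynomial.coe_evalRingHom, Polynomial.eval_finsetSum,
        linSubst_diagonal_pow_eq_sum w s (W + e) (L a b) (hwL a b)]
      refine Finset.sum_congr rfl fun j _ => ?_
      rw [Polynomial.eval_monomial, ← map_pow]
      simp only [hB, Matrix.of_apply]
      ring
    have h2 : linSubst σ ℂ (Matrix.diagonal fun i => s ^ (w i)) L.det =
        ((linSubst σ ℂ (Matrix.diagonal fun i => s ^ (w i))).toRingHom.mapMatrix L).det := by
      rw [← RingHom.map_det]; rfl
    have h1 : Λ.det.eval (C s) = linSubst σ ℂ (Matrix.diagonal fun i => s ^ (w i)) L.det := by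
      rw [← Polynomial.coe_evalRingHom, RingHom.map_det, h2]
      congr 1
      ext a b
      rw [RingHom.mapMatrix_apply, Matrix.map_apply, hentry a b]
      rfl
    rw [hQ, Polynomial.eval_sub, h1, Polynomial.eval_finsetSum,
      linSubst_diagonal_pow_eq_sum w s N L.det hwDet, sub_eq_zero]
    refine Finset.sum_congr rfl fun v _ => ?_
    rw [Polynomial.eval_monomial, ← map_pow, mul_comm]
  have hQ0 : Q = 0 := by
    apply Polynomial.eq_zero_of_infinite_isRoot
    have hsub : Set.range (fun n : ℕ => (C (n : ℂ) : MvPolynomial σ ℂ)) ⊆ {x | Q.IsRoot x} := by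
      rintro _ ⟨n, rfl⟩
      exact heval n
    refine Set.Infinite.mono hsub (Set.infinite_range_of_injective ?_)
    intro a b hab
    exact Nat.cast_injective ((C_injective σ ℂ) hab)
  -- compare the coefficients of `ε^e`
  have hcoeff := congrArg (fun p : Polynomial (MvPolynomial σ ℂ) => p.coeff e) hQ0
  simp only [hQ, Polynomial.coeff_sub, Polynomial.coeff_zero, Polynomial.finsetSum_coeff,
    Polynomial.coeff_monomial, sub_eq_zero] at hcoeff
  rw [Finset.sum_ite_eq' (Finset.range (N + 1)) e, if_pos (Finset.mem_range.mpr (by omega))] at hcoeff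
  rw [← hcoeff]

/-- **The toric slices of a translated determinant as `ε`-coefficients.**  For every square matrix
`g` on the `m²` variables, weight `w` and level `e`:
`wHC_w^e (g · det_m) = [ε^e] det (B₀ + ε B₁ + ⋯ + ε^e B_e)` with the LINEAR layers
`(B_j)_{ab} := wHC_w^j (g · x_{ab})` (`g · x_{ab}` = the linear form `linSubst g (X (a,b))`).  So an
(extremal or not) toric representation of a form at level `e` is an order-`e` coefficient of a
holomorphic family of honest `m × m` determinants of linear forms — the input shape of
`hasDetRepr_coeff_det_layers`; rescaling rows and columns by powers of `ε` (potentials) lowers the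
order without changing the family's size. [folklore] -/
theorem weightedHomogeneousComponent_linSubst_detPoly_eq_coeff (m : ℕ)
    (g : Matrix (Fin m × Fin m) (Fin m × Fin m) ℂ) (w : Fin m × Fin m → ℕ) (e : ℕ) :
    weightedHomogeneousComponent w e (linSubst (Fin m × Fin m) ℂ g (detPoly (Fin m) ℂ)) =
      (Matrix.det (Matrix.of fun a b => ∑ j ∈ Finset.range (e + 1),
        Polynomial.monomial j (weightedHomogeneousComponent w j
          (linSubst (Fin m × Fin m) ℂ g (X (a, b)))))).coeff e := by
  have hdet : linSubst (Fin m × Fin m) ℂ g (detPoly (Fin m) ℂ) =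
      ((linSubst (Fin m × Fin m) ℂ g).toRingHom.mapMatrix (Matrix.mvPolynomialX (Fin m) (Fin m) ℂ)).det := by
    rw [detPoly, ← RingHom.map_det]; rfl
  rw [hdet, weightedHomogeneousComponent_det_eq_coeff _ (fun a b => ?_) w e]
  · rfl
  · rw [RingHom.mapMatrix_apply, Matrix.map_apply, Matrix.mvPolynomialX_apply]
    exact linSubst_isHomogeneous g (isHomogeneous_X ℂ (a, b))

/-- The layers `wHC_w^j (g · x_{ab})` of the previous theorem are linear forms. [folklore] -/
theorem isHomogeneous_layer (m : ℕ) (g : Matrix (Fin m × Fin m) (Fin m × Fin m) ℂ)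
    (w : Fin m × Fin m → ℕ) (j : ℕ) (a b : Fin m) :
    (weightedHomogeneousComponent w j (linSubst (Fin m × Fin m) ℂ g (X (a, b)))).IsHomogeneous 1 :=
  isHomogeneous_weightedHomogeneousComponent (linSubst_isHomogeneous g (isHomogeneous_X ℂ (a, b))) w j

/-- **De-bordering by order, packaged** (registered stub `stub_deborderOrder` of crux stmt-5778, line
`toric-face-debordering`, reshape 4; constants `C₀ = 3`, `e₀ = 10`): universal constants such that for
every finite variable set, all `m, k` and all linear layers `B₀, …, B_k` of size `m`, the order-`k`
coefficient `[ε^k] det (Σ_{j ≤ k} ε^j B_j)` has an affine determinantal expression of size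
`C₀ ((m+1)(k+1))^e₀`. [folklore] -/
theorem stub_deborderOrder : ∃ C₀ e₀ : ℕ, ∀ (σ : Type) [Fintype σ] [DecidableEq σ] (m k : ℕ) (B : ℕ → Matrix (Fin m) (Fin m) (MvPolynomial σ ℂ)), (∀ j a b, (B j a b).IsHomogeneous 1) → HasDetRepr ((Matrix.det (Matrix.of fun a b => ∑ j ∈ Finset.range (k + 1), Polynomial.monomial j (B j a b))).coeff k) (C₀ * ((m + 1) * (k + 1)) ^ e₀) :=
  ⟨3, 10, fun _ _ _ m k B hB => hasDetRepr_coeff_det_layers m k B hB⟩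

end Summit.ValiantsHypothesis.ValiantsHypothesis.Theorems.BorderApolarityFixedWitnessObstructionQP
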